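import Literature.AnabelianGeometry.EtaleTheta.Setting
import Literature.AnabelianGeometry.EtaleTheta.RootsOfUnityGalois
import Mathlib.GroupTheory.Index
import Mathlib.Topology.Algebra.OpenSubgroup
import Mathlib.Data.ZMod.Basic
import HarnessLib

/-!
# [EtTh] §2 over §1: `l·Δ_Θ`, the standing hypothesis "`K = K̈`", and the identification
# `μ_N ≅ (l·Δ_Θ) ⊗ ℤ/Nℤ` over the §1 theta setting (merge adapter, part 0)

Mochizuki, *The étale theta function …*, Publ. RIMS **45** (2009), §2, PRIMS PDF pp. 39, 41, 44–46
(printed 265, 267, 270–272) [cite: MochizukiEtTh2009, Def 2.13 p.46]. Layer L2 of the abc-iut cell,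
wave-2 unit W2-L2-04 (plan/L2/ASSIGNMENTS.md §I: merge adapter seat abc-iut-L2-t1 → abc-iut-L2-t2),
seat abc-iut-L2-t8. This part depends only on the §1 ROOT `Setting.lean` (seat abc-iut-L2-t1) and on
`RootsOfUnityGalois.lean`; parts 1–3 (`DoubleUnderline.lean` → `ThetaEnvOfSetting.lean` →
`RigidOfSetting.lean`) instantiate abc-iut-L2-t2's interfaces `ThetaEnvData N` / `RigidData N l`.

Contents (over `D : ThetaSetting p`):
* `ThetaSetting.lDeltaTheta D l` — "`l · Δ_Θ`" (pp. 41, 45), the `l`-th powers in the commutative group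
  `Δ_Θ ⊆ (Π^tp_X)^Θ` — a definition, with `l·Δ_Θ ⊆ Δ_Θ` and normality PROVED;
* `ThetaSetting.Sec2Hyps D` — "`K = K̈`" (Def. 2.5, p. 39, as `D.Kdd = D.K`) and ONE containment among
  the §1 groups that §2 invokes and `Setting.lean` does not record (`Π^tp_{Y_N} ⊇ Ker(Π^tp_Y ↠ (Π^tp_Y)^ell)`,
  p. 13); TODO-merge(abc-iut-L2-t1): candidate root axiom (cf. `ThetaSetting.Compat`); consequences
  PROVED: `G_K̈ = G_K`, `Π^tp_Y = Π^tp_{Y₂} · Δ^tp_Y`;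
* `ThetaSetting.ker_toEll_le_GtpY` — `Ker(Π^tp_X ↠ (Π^tp_X)^ell) ⊆ Π^tp_Y` (p. 12: `Δ^tp_X ↠ Z` factors through
  `(Δ^tp_X)^ell`) PROVED from the root axioms via the profinite completion (`IsProfiniteCompletion`);
* `ThetaSetting.CyclotomeMod D l N` — "the natural isomorphism `μ_N ≅ (l·Δ_Θ) ⊗ (ℤ/Nℤ)`" (p. 46) with
  the REAL cyclotome `μ_N ⊆ ℚ̄_p^×` (`MuN p N`, Galois action `galMuN`): a continuous equivariant
  surjection `(l·Δ_Θ) ↠ μ_N` with kernel the `N`-th powers — the level-`N` content of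
  "`Δ_Θ (≅ Ẑ(1))`" (p. 12), which `Setting.lean` defers; TODO-merge(abc-iut-L3-t2)
  (`DeltaThetaIsoTate`). DATA, not an assertion. PROVED from it: the kernel of the mod-`N` cyclotomic
  character `Π^tp_X → Aut(μ_N)` is open.

HONEST FRAMING: [EtTh] is refereed; the two structures are hypotheses/data quoting print and are not
asserted; no side is taken on any disputed claim.
-/

noncomputable section

namespace Literature.AnabelianGeometry.EtaleTheta

open Literature.AnabelianGeometry.SemiGraphs

namespace ThetaSetting

variable {p : ℕ} [Fact p.Prime] (D : ThetaSetting p)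

/-! ### `l·Δ_Θ` -/

/-- **`l · Δ_Θ ⊆ Δ_Θ`** (p. 41 "`H¹(Π^tp_Ÿ̲̲, l·Δ_Θ)`", p. 45 "`l · Δ_Θ ⊆ Δ^Θ_*`"): the subgroup of `l`-th
powers of the commutative group `Δ_Θ ⊆ (Π^tp_X)^Θ` (written multiplicatively).
[cite: MochizukiEtTh2009, Prop 2.12 (i) p.45] -/
def lDeltaTheta (l : ℕ) : Subgroup D.GtpTheta where
  carrier := {x | ∃ y ∈ D.DeltaTheta, y ^ l = x}
  one_mem' := ⟨1, one_mem _, one_pow _⟩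
  mul_mem' := by
    rintro _ _ ⟨a, ha, rfl⟩ ⟨b, hb, rfl⟩
    refine ⟨a * b, mul_mem ha hb, ?_⟩
    have hab : Commute a b := D.ker_thetaToEll_comm a ha b hb
    exact hab.mul_pow l
  inv_mem' := by
    rintro _ ⟨a, ha, rfl⟩
    exact ⟨a⁻¹, inv_mem ha, by rw [inv_pow]⟩

/-- `l·Δ_Θ ⊆ Δ_Θ`. [cite: MochizukiEtTh2009, Prop 2.12 (i) p.45] -/
theorem lDeltaTheta_le (l : ℕ) : D.lDeltaTheta l ≤ D.DeltaTheta := by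
  rintro _ ⟨a, ha, rfl⟩
  exact pow_mem ha l

/-- `l·Δ_Θ` is normal in `(Π^tp_X)^Θ` (as `Δ_Θ` is). [cite: MochizukiEtTh2009, Prop 2.12 (i) p.45] -/
instance lDeltaTheta_normal (l : ℕ) : (D.lDeltaTheta l).Normal where
  conj_mem := by
    rintro _ ⟨a, ha, rfl⟩ t
    refine ⟨t * a * t⁻¹, (inferInstanceAs D.thetaToEll.ker.Normal : D.DeltaTheta.Normal).conj_mem a ha t,
      ?_⟩
    rw [conj_pow]

/-! ### Hypotheses on the root data invoked by §2 -/

/-- **Hypotheses on the §1 groups that §2 invokes** and that the root file `Setting.lean` does not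
record (each a printed sentence; TODO-merge(abc-iut-L2-t1): candidate root axiom, cf.
`ThetaSetting.Compat`), under the standing assumption of Def. 2.5 "`K = K̈`" (p. 39; Def. 1.7 (I), p. 27).
(The companion containment `Ker(Π^tp_X ↠ (Π^tp_X)^ell) ⊆ Π^tp_Y` of p. 12 is PROVED below from the
profinite-completion axiom of the tree's `TemperedCurve`: `ker_toEll_le_GtpY`.)
[cite: MochizukiEtTh2009, Def 2.5 p.39] -/
structure Sec2Hyps : Prop where
  /-- "`K = K̈`" (Def. 2.5, p. 39; Def. 1.7 (I), p. 27): `K̈ = K₂ = K(ζ₂, q_X^{1/2})` equals `K`. -/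
  Kdd_eq : D.Kdd = D.K
  /-- `Π^tp_{Y_N} ⊇ Ker(Π^tp_Y ↠ (Π^tp_Y)^ell)`: the covering `Y_N → Y` is cut out by "an open immersion
  `G_{K_N} ↪ (Π^tp_Y)^ell/N·(Δ^tp_Y)^ell` the image of which … determines a Galois covering `Y_N → Y`"
  (p. 13). -/
  ker_toEll_le_GtpYN : ∀ N, (D.thetaToEll.comp D.toTheta).ker ⊓ D.GtpY ≤ D.GtpYN N

/-! ### `Ker(Π^tp_X ↠ (Π^tp_X)^ell) ⊆ Π^tp_Y`, from the profinite completion -/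

/-- `Π^tp_X ↠ Z = ℤ ↠ ℤ/nℤ` (multiplicatively). [cite: MochizukiEtTh2009, §1 p.12] -/
def toZMod (n : ℕ) : D.PiTemp →* Multiplicative (ZMod n) :=
  (AddMonoidHom.toMultiplicative (Int.castAddHom (ZMod n))).comp D.toZ

/-- `toZMod n x = 1 ↔ n ∣ toZ x`. [cite: MochizukiEtTh2009, §1 p.12] -/
theorem toZMod_eq_one_iff (n : ℕ) (x : D.PiTemp) :
    D.toZMod n x = 1 ↔ (n : ℤ) ∣ Multiplicative.toAdd (D.toZ x) := by
  rw [← ZMod.intCast_zmod_eq_zero_iff_dvd]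
  change Multiplicative.ofAdd (((Multiplicative.toAdd (D.toZ x) : ℤ) : ZMod n)) = 1 ↔ _
  rw [ofAdd_eq_one]

/-- Every commutator of the profinite completion `Π_X` dies in the (profinite) quotient attached to the
open normal finite-index subgroup `Ker(Π^tp_X → ℤ/nℤ)` — density of `Π^tp_X` in `Π_X` and commutativity of
`ℤ/nℤ`. [cite: MochizukiEtTh2009, §1 p.12] -/
theorem commutator_mem_of_comap_eq {n : ℕ} (V : OpenNormalSubgroup D.PiHat)
    (hV : (D.toZMod n).ker = V.toSubgroup.comap D.toHat.toMonoidHom) (a b : D.PiHat) :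
    a * b * a⁻¹ * b⁻¹ ∈ V.toSubgroup := by
  have hclosed : IsClosed {q : D.PiHat × D.PiHat |
      q.1 * q.2 * q.1⁻¹ * q.2⁻¹ ∈ (V.toSubgroup : Set D.PiHat)} :=
    V.toOpenSubgroup.isClosed.preimage (by fun_prop)
  have hdense : DenseRange (Prod.map D.toHat D.toHat) :=
    D.isProfiniteCompletion_toHat.denseRange.prodMap D.isProfiniteCompletion_toHat.denseRange
  have hsub : Set.range (Prod.map D.toHat D.toHat) ⊆ {q : D.PiHat × D.PiHat |
      q.1 * q.2 * q.1⁻¹ * q.2⁻¹ ∈ (V.toSubgroup : Set D.PiHat)} := by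
    rintro _ ⟨⟨y, z⟩, rfl⟩
    change D.toHat y * D.toHat z * (D.toHat y)⁻¹ * (D.toHat z)⁻¹ ∈ (V.toSubgroup : Set D.PiHat)
    have hyz : y * z * y⁻¹ * z⁻¹ ∈ V.toSubgroup.comap D.toHat.toMonoidHom := by
      rw [← hV, MonoidHom.mem_ker, map_mul, map_mul, map_mul, map_inv, map_inv, mul_inv_cancel_comm,
        mul_inv_cancel]
    have hyz' : D.toHat.toMonoidHom (y * z * y⁻¹ * z⁻¹) ∈ V.toSubgroup := hyz
    simp only [map_mul, map_inv] at hyz'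
    exact hyz'
  have huniv := hclosed.closure_subset_iff.2 hsub
  rw [hdense.closure_range] at huniv
  exact huniv (Set.mem_univ (a, b))

/-- **`Ker(Π^tp_X ↠ (Π^tp_X)^ell) ⊆ Π^tp_Y`**: the surjection `Δ^tp_X ↠ Z` factors through `(Δ^tp_X)^ell`
("`1 → Ẑ(1) → (Δ^tp_X)^ell → Z → 1`", p. 12) — PROVED from the root axioms: the pull-back to `Π^tp_X` of
the closure of `[Δ_X, Δ_X]` in the profinite completion `Π_X` lies in `Ker(Π^tp_X → ℤ/nℤ)` for every
`n ≥ 1` (that kernel comes from an open normal subgroup of `Π_X` by `IsProfiniteCompletion`, whose quotient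
is abelian by density), hence in `Ker(Π^tp_X ↠ Z)`. [cite: MochizukiEtTh2009, §1 p.12] -/
theorem ker_toEll_le_GtpY : (D.thetaToEll.comp D.toTheta).ker ≤ D.GtpY := by
  intro x hx
  rw [D.ker_toEll] at hx
  have key : ∀ n : ℕ, 0 < n → (n : ℤ) ∣ Multiplicative.toAdd (D.toZ x) := by
    intro n hn
    haveI : NeZero n := ⟨hn.ne'⟩
    have hopen : IsOpen ((D.toZMod n).ker : Set D.PiTemp) := by
      refine Subgroup.isOpen_mono (fun y hy => ?_) D.isOpen_ker_toZ
      rw [MonoidHom.mem_ker] at hy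
      rw [MonoidHom.mem_ker, toZMod_eq_one_iff, hy, toAdd_one]
      exact dvd_zero _
    let U : OpenNormalSubgroup D.PiTemp :=
      { toSubgroup := (D.toZMod n).ker, isOpen' := hopen, isNormal' := inferInstance }
    have hfi : U.toSubgroup.FiniteIndex := by
      refine ⟨?_⟩
      change (D.toZMod n).ker.index ≠ 0
      rw [Subgroup.index_ker]
      exact Nat.card_pos.ne'
    obtain ⟨V, hV⟩ := D.isProfiniteCompletion_toHat.comap_surjective U hfi
    have hle : (⁅D.DeltaHat, D.DeltaHat⁆).topologicalClosure ≤ V.toSubgroup :=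
      Subgroup.topologicalClosure_minimal _ (Subgroup.commutator_le.2 fun a _ b _ => by
        rw [commutatorElement_def]; exact D.commutator_mem_of_comap_eq V hV a b)
        V.toOpenSubgroup.isClosed
    have hxU : x ∈ (D.toZMod n).ker := by
      change x ∈ U.toSubgroup
      rw [hV]
      exact Subgroup.comap_mono hle hx
    rw [MonoidHom.mem_ker, toZMod_eq_one_iff] at hxU
    exact hxU
  change x ∈ D.toZ.ker
  rw [MonoidHom.mem_ker]
  have h0 : Multiplicative.toAdd (D.toZ x) = 0 :=
    Int.eq_zero_of_dvd_of_natAbs_lt_natAbs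
      (key ((Multiplicative.toAdd (D.toZ x)).natAbs + 1) (Nat.succ_pos _))
      (by rw [Int.natAbs_natCast]; exact Nat.lt_succ_self _)
  exact Multiplicative.toAdd.injective h0

variable {D} in
/-- Under `K = K̈`: `G_K̈ = G_K` inside `G_{ℚ_p}`. [cite: MochizukiEtTh2009, Def 2.5 p.39] -/
theorem Sec2Hyps.GKdd_eq (hS : D.Sec2Hyps) : D.GKdd = D.GK := by
  change (fieldKN D.K D.qX 2).fixingSubgroup = D.K.fixingSubgroup
  exact congrArg IntermediateField.fixingSubgroup hS.Kdd_eq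

/-- The image of `Π^tp_X` in `G_{ℚ_p}` is `G_K` (`range_aug`): every `aug(x)` lies in `G_K`.
[cite: MochizukiEtTh2009, §1 p.12] -/
theorem aug_mem_GK (x : D.PiTemp) : D.aug.toMonoidHom x ∈ D.GK := by
  have hx : D.aug.toMonoidHom x ∈ D.aug.toMonoidHom.range := ⟨x, rfl⟩
  rw [D.range_aug] at hx
  exact hx

/-- Hence the pull-back of `G_K` to `Π^tp_X` is everything. [cite: MochizukiEtTh2009, §1 p.12] -/
theorem comap_aug_GK : D.GK.comap D.aug.toMonoidHom = ⊤ :=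
  eq_top_iff.2 fun x _ => D.aug_mem_GK x

variable {D} in
/-- `Π^tp_Y = Π^tp_{Y₂} · Δ^tp_Y` under `K = K̈`: the image of `Π^tp_{Y₂}` in `G_{ℚ_p}` is `G_{K₂} = G_K`,
the image of all of `Π^tp_X` (p. 13). [cite: MochizukiEtTh2009, §1 p.13] -/
theorem GtpY_eq_sup (hS : D.Sec2Hyps) : D.GtpY = D.GtpYN 2 ⊔ (D.GtpY ⊓ D.DeltaTemp) := by
  refine le_antisymm ?_ (sup_le (D.GtpYN_le 2) inf_le_left)
  intro y hy
  have h2 : D.GKN 2 = D.GK := hS.GKdd_eq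
  have hy' : D.aug.toMonoidHom y ∈ (D.GtpYN 2).map D.aug.toMonoidHom := by
    rw [D.map_aug_GtpYN]
    change D.aug.toMonoidHom y ∈ D.GKN 2
    rw [h2]
    exact D.aug_mem_GK y
  obtain ⟨y', hy'mem, hyy'⟩ := hy'
  have hk : y'⁻¹ * y ∈ D.DeltaTemp := by
    change y'⁻¹ * y ∈ D.aug.toMonoidHom.ker
    rw [MonoidHom.mem_ker, map_mul, map_inv, hyy', inv_mul_cancel]
  have hy'Y : y' ∈ D.GtpY := D.GtpYN_le 2 hy'mem
  have hmem : y'⁻¹ * y ∈ D.GtpY ⊓ D.DeltaTemp :=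
    Subgroup.mem_inf.2 ⟨D.GtpY.mul_mem (D.GtpY.inv_mem hy'Y) hy, hk⟩
  have : y = y' * (y'⁻¹ * y) := by group
  rw [this]
  exact mul_mem (Subgroup.mem_sup_left hy'mem) (Subgroup.mem_sup_right hmem)

/-! ### The identification of `μ_N` with `(l·Δ_Θ) ⊗ ℤ/Nℤ` -/

/-- **"The natural isomorphism `μ_N ≅ (l·Δ_Θ) ⊗ (ℤ/Nℤ)`"** (p. 46) between the cyclotome
`μ_N = ℤ/Nℤ(1) ⊆ ℚ̄_p^×` (p. 44; `MuN p N`, a real object with its Galois action `galMuN`) and the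
level-`N` quotient of `l·Δ_Θ`, carried as a continuous `G_K`-equivariant surjection `(l·Δ_Θ) ↠ μ_N` with
kernel the `N`-th powers — the level-`N` content of "`Δ_Θ (≅ Ẑ(1))`" as a Galois module (p. 12),
which `Setting.lean` defers; TODO-merge(abc-iut-L3-t2) (`DeltaThetaIsoTate`): at the merge this
structure is CONSTRUCTED from `Δ_Θ ≅ Ẑ(1)`. DATA, not an assertion. [cite: MochizukiEtTh2009, Def 2.13 p.46] -/
structure CyclotomeMod (l : ℕ) (N : ℕ+) : Type where
  /-- "the natural isomorphism `μ_N ≅ (l·Δ_Θ) ⊗ (ℤ/Nℤ)`" (p. 46), as the surjection `(l·Δ_Θ) ↠ μ_N` … -/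
  red : D.lDeltaTheta l →* MuN p N
  /-- … which is onto … -/
  red_surjective : Function.Surjective red
  /-- … with kernel `N · (l·Δ_Θ)` (the `N`-th powers; `⊗ ℤ/Nℤ`) … -/
  red_ker : ∀ x, red x = 1 ↔ ∃ y : D.lDeltaTheta l, x = y ^ (N : ℕ)
  /-- … continuous (`Δ_Θ ≅ Ẑ(1)` is profinite, p. 12) … -/
  continuous_red : Continuous red
  /-- … and `G_K`-equivariant for the conjugation action of `Π^tp_X` on `Δ_Θ ⊆ (Π^tp_X)^Θ` and the
  Galois action on `μ_N ⊆ ℚ̄_p` ("natural"; "`Δ_Θ (≅ Ẑ(1))`" as a Galois module, p. 12). -/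
  red_conj : ∀ (σ : D.PiTemp) (x : D.lDeltaTheta l),
    red ⟨D.toTheta σ * x * (D.toTheta σ)⁻¹, (D.lDeltaTheta_normal l).conj_mem _ x.2 _⟩ =
      galMuN p N (D.aug.toMonoidHom σ) (red x)

variable {D} in
/-- The stabiliser in `Π^tp_X` of an element of `μ_N` is open (continuity of `red` and of conjugation).
[cite: MochizukiEtTh2009, Def 2.10 p.44] -/
theorem CyclotomeMod.isOpen_stabilizer {l : ℕ} {N : ℕ+} (μ : D.CyclotomeMod l N) (m : MuN p N) :
    IsOpen {σ : D.PiTemp | galMuN p N (D.aug.toMonoidHom σ) m = m} := by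
  obtain ⟨x, rfl⟩ := μ.red_surjective m
  have hcont : Continuous fun σ : D.PiTemp =>
      (⟨D.toTheta σ * x * (D.toTheta σ)⁻¹, (D.lDeltaTheta_normal l).conj_mem _ x.2 _⟩ :
        D.lDeltaTheta l) := by
    apply Continuous.subtype_mk
    exact ((D.continuous_toTheta.mul continuous_const).mul D.continuous_toTheta.inv)
  have : {σ : D.PiTemp | galMuN p N (D.aug.toMonoidHom σ) (μ.red x) = μ.red x} =
      (fun σ : D.PiTemp => μ.red ⟨D.toTheta σ * x * (D.toTheta σ)⁻¹,
        (D.lDeltaTheta_normal l).conj_mem _ x.2 _⟩) ⁻¹' {μ.red x} := by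
    ext σ
    simp only [Set.mem_setOf_eq, Set.mem_preimage, Set.mem_singleton_iff, μ.red_conj]
  rw [this]
  exact (isOpen_discrete _).preimage (μ.continuous_red.comp hcont)

variable {D} in
/-- The kernel of the mod-`N` cyclotomic character `Π^tp_X → G_{ℚ_p} → Aut(μ_N)` is open (given the
identification `red`, through which `μ_N` is a quotient of the topological group `l·Δ_Θ`).
[cite: MochizukiEtTh2009, Def 2.10 p.44] -/
theorem CyclotomeMod.isOpen_ker_chi {l : ℕ} {N : ℕ+} (μ : D.CyclotomeMod l N) :
    IsOpen ((((galMuN p N).comp D.aug.toMonoidHom).ker : Subgroup D.PiTemp) : Set D.PiTemp) := by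
  have : ((((galMuN p N).comp D.aug.toMonoidHom).ker : Subgroup D.PiTemp) : Set D.PiTemp) =
      ⋂ m : MuN p N, {σ : D.PiTemp | galMuN p N (D.aug.toMonoidHom σ) m = m} := by
    ext σ
    simp only [SetLike.mem_coe, MonoidHom.mem_ker, MonoidHom.coe_comp, Function.comp_apply,
      Set.mem_iInter, Set.mem_setOf_eq]
    constructor
    · intro h m
      rw [h]
      rfl
    · intro h
      ext m
      exact congrArg (fun u : MuN p N => (((u : (PadicAlgCl p)ˣ) : PadicAlgCl p))) (h m)
  rw [this]
  exact isOpen_iInter_of_finite fun m => μ.isOpen_stabilizer m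

end ThetaSetting

end Literature.AnabelianGeometry.EtaleTheta

end
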